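import Summits.Ventures.LatticeQCDFlow.Exactness.ReversibleNeumannSums
import Summits.Ventures.LatticeQCDFlow.Exactness.ReversibleAutocovMonotone
import Summits.Ventures.LatticeQCDFlow.Scoring.CalibrationTruths
import HarnessLib

/-!
# Geyer's pair sums for EVERY reversible exact sampler: `Γ_m = C(2m) + C(2m+1)` is nonnegative, nonincreasing and convex; odd windows never overshoot `τ_int`

HONEST FRAMING: exact (Metropolis-corrected) sampling algorithms for lattice gauge theory;
figures of merit are autocorrelation/cost numbers at stated couplings and volumes; no
continuum-physics claim.  (SCALAR calibration rung S0-A: not a gauge result.)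

Venture `LatticeQCDFlow` (cell pub-lqcd), topic `Exactness`; FANOUT row 2 (`s0-phi4`).  NEW WORK of
the cell in the `RevOp` format (`Exactness/ReversibleOperatorL2.lean`: weight `w ≥ 0`, admissible
class `A` with (int) (comb), operator `K` with (stab) (lin) (symm) (contr) — every exact reversible
sampler of the tree: the local Metropolis arm, HMC of every integrator, the flow sampler, their
mixtures and lazy versions).  NO positivity is assumed here.  Nothing is cited as a fact; two
applications of pair positivity (`RevOp.pair_nonneg`) and of the Dirichlet form.  Printed
counterpart NAMED ONLY: Geyer 1992, *Practical Markov chain Monte Carlo*, Statist. Sci. 7, Thm 3.1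
(for a reversible chain the pair sums `Γ_m = γ_{2m} + γ_{2m+1}` are strictly positive, strictly
decreasing, strictly convex — via the spectral theorem; the basis of the initial positive /
monotone / convex sequence estimators of the asymptotic variance; restated in Geyer, *Introduction
to MCMC*, Handbook of MCMC 2011, §1.10.2).  Here: non-strict, on an admissible class of a general
state space, WITHOUT the spectral theorem — `Γ_m − Γ_{m+1}` is the Dirichlet form of `(1 + K)Kᵐu` and
`Γ_m − 2Γ_{m+1} + Γ_{m+2}` is the pair form `‖y‖² + ⟨y, Ky⟩` of `y = (1 − K²)Kᵐu`.

## What is proved (namespace `RevOp`; `a(k) = ∫ u (Kᵏ u) w`, `Γ_m = a(2m) + a(2m+1)`)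

* `autocov_test_iterate` — autocovariances of the test observable `Kⁱ u + c u`:
  `∫ h (Kⁿ h) w = a(n + 2i) + 2c a(n + i) + c² a(n)`;
* **`pairSum_succ_le`** — `Γ_{m+1} ≤ Γ_m`;  **`pairSum_convex`** — `Γ_{m+1} − Γ_{m+2} ≤ Γ_m − Γ_{m+1}`;
  `pairSum_le_first` — `Γ_m ≤ a(0) + a(1)` (with `RevOp.pair_nonneg`: `0 ≤ Γ_m`);
* `sum_tail_pairs_nonneg`, `tsum_even_tail_nonneg` — every tail that starts at an EVEN lag has a
  nonnegative sum: `0 ≤ Σ_{k ≥ 2N} a(k)` (summable case);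
* **`tauIntWindow_odd_le_tauInt`** — for EVERY reversible exact sampler and every observable of the
  class, the window closed after an odd lag never overshoots: `τ_{2N+1} = ½ + Σ_{k ≤ 2N+1} ρ(k) ≤ τ_int`
  (even cut-offs can overshoot — alternating chains; for POSITIVE samplers every cut-off is safe,
  `Exactness/ReversiblePositiveTauInt.lean`);
* `succ_mul_pairSum_le_sum`, **`succ_mul_pairSum_le_tauInt`** — PAIR DECAY:
  `(N + 1)(ρ(2N) + ρ(2N+1)) ≤ τ_int + ½` — the
  autocorrelations of any observable under any reversible exact sampler decay, in pairs, at least as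
  fast as `(τ_int + ½)/(N+1)` (monotone nonnegative pair sums with total `τ_int + ½`).

Reading for the scorers (no numerics implied): an automatic-windowing `τ_int` estimate truncated
after an odd lag is, in expectation over the true autocorrelation function, a FLOOR for every
reversible arm of the calibration; Geyer's monotone/convex regularisations are licensed for all
three arms.  NOT CLAIMED: strict inequalities; estimator consistency; non-reversible updates.
-/

namespace Summit.Ventures.LatticeQCDFlow.Exactness

open Real MeasureTheory Filter Finset Topology
open Summit.Ventures.LatticeQCDFlow.Scoring

namespace RevOp

variable {X : Type*} [MeasurableSpace X] {μ : Measure X} {w : X → ℝ} {A : (X → ℝ) → Prop}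
  {K : (X → ℝ) → (X → ℝ)}

/-! ## §1 Test observables `Kⁱ u + c u` -/

/-- Autocovariances of the test observable `h = Kⁱ u + c u`:
`∫ h (Kⁿ h) w = a(n + 2i) + 2c a(n + i) + c² a(n)`. -/
theorem autocov_test_iterate
    (hAi : ∀ ⦃f h : X → ℝ⦄, A f → A h → Integrable (fun x => f x * h x * w x) μ)
    (hAK : ∀ ⦃f : X → ℝ⦄, A f → A (K f))
    (hlin : ∀ ⦃f h : X → ℝ⦄ (c : ℝ), A f → A h →
      ∀ x, K (fun s => f s + c * h s) x = K f x + c * K h x)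
    (hsymm : ∀ ⦃f h : X → ℝ⦄, A f → A h →
      ∫ x, K f x * h x * w x ∂μ = ∫ x, f x * K h x * w x ∂μ)
    {u : X → ℝ} (hu : A u) (c : ℝ) (i n : ℕ) :
    ∫ x, ((K^[i] u) x + c * u x) * (K^[n] (fun s => (K^[i] u) s + c * u s)) x * w x ∂μ
      = (∫ x, u x * (K^[n + 2 * i] u) x * w x ∂μ) + 2 * c * (∫ x, u x * (K^[n + i] u) x * w x ∂μ)
        + c ^ 2 * ∫ x, u x * (K^[n] u) x * w x ∂μ := by
  have hui := iterate_mem hAK i hu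
  have hn := iterate_mem hAK n hu
  have hni := iterate_mem hAK (n + i) hu
  have hlinn := iterate_add_mul hAK hlin c n hui hu
  have e : ∀ x, ((K^[i] u) x + c * u x) * (K^[n] (fun s => (K^[i] u) s + c * u s)) x * w x
      = (K^[i] u) x * (K^[n + i] u) x * w x + c * ((K^[i] u) x * (K^[n] u) x * w x)
        + c * (u x * (K^[n + i] u) x * w x) + c ^ 2 * (u x * (K^[n] u) x * w x) := by
    intro x
    rw [hlinn x, ← Function.iterate_add_apply K n i u]
    ring
  rw [integral_congr_ae (Eventually.of_forall e)]
  have i1 : Integrable (fun x => (K^[i] u) x * (K^[n + i] u) x * w x) μ := hAi hui hni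
  have i2 : Integrable (fun x => c * ((K^[i] u) x * (K^[n] u) x * w x)) μ := (hAi hui hn).const_mul _
  have i3 : Integrable (fun x => c * (u x * (K^[n + i] u) x * w x)) μ := (hAi hu hni).const_mul _
  have i4 : Integrable (fun x => c ^ 2 * (u x * (K^[n] u) x * w x)) μ := (hAi hu hn).const_mul _
  have i12 : Integrable (fun x => (K^[i] u) x * (K^[n + i] u) x * w x
      + c * ((K^[i] u) x * (K^[n] u) x * w x)) μ := i1.add i2
  have i123 : Integrable (fun x => (K^[i] u) x * (K^[n + i] u) x * w x
      + c * ((K^[i] u) x * (K^[n] u) x * w x) + c * (u x * (K^[n + i] u) x * w x)) μ := i12.add i3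
  rw [integral_add i123 i4, integral_add i12 i3, integral_add i1 i2,
    integral_const_mul, integral_const_mul, integral_const_mul]
  have e1 : ∫ x, (K^[i] u) x * (K^[n + i] u) x * w x ∂μ = ∫ x, u x * (K^[n + 2 * i] u) x * w x ∂μ := by
    rw [two_time hAK hsymm hu i (n + i), show i + (n + i) = n + 2 * i by ring]
  have e2 : ∫ x, (K^[i] u) x * (K^[n] u) x * w x ∂μ = ∫ x, u x * (K^[n + i] u) x * w x ∂μ := by
    rw [two_time hAK hsymm hu i n, show i + n = n + i by ring]
  rw [e1, e2]
  ring

/-! ## §2 The pair sums `Γ_m = a(2m) + a(2m+1)`: nonincreasing and convex -/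

/-- **Geyer's monotonicity, every reversible exact sampler**: `Γ_{m+1} ≤ Γ_m`, i.e.
`a(2m+2) + a(2m+3) ≤ a(2m) + a(2m+1)` — the difference is the Dirichlet form of `z = K v + v`,
`v = Kᵐ u`: `‖z‖² − ⟨z, Kz⟩ ≥ 0`. -/
theorem pairSum_succ_le (hw0 : ∀ x, 0 ≤ w x)
    (hAi : ∀ ⦃f h : X → ℝ⦄, A f → A h → Integrable (fun x => f x * h x * w x) μ)
    (hAc : ∀ ⦃f h : X → ℝ⦄ (c : ℝ), A f → A h → A (fun x => f x + c * h x))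
    (hAK : ∀ ⦃f : X → ℝ⦄, A f → A (K f))
    (hlin : ∀ ⦃f h : X → ℝ⦄ (c : ℝ), A f → A h →
      ∀ x, K (fun s => f s + c * h s) x = K f x + c * K h x)
    (hsymm : ∀ ⦃f h : X → ℝ⦄, A f → A h →
      ∫ x, K f x * h x * w x ∂μ = ∫ x, f x * K h x * w x ∂μ)
    (hcontr : ∀ ⦃f : X → ℝ⦄, A f → ∫ x, K f x ^ 2 * w x ∂μ ≤ ∫ x, f x ^ 2 * w x ∂μ)
    {u : X → ℝ} (hu : A u) (m : ℕ) :
    (∫ x, u x * (K^[2 * m + 2] u) x * w x ∂μ) + ∫ x, u x * (K^[2 * m + 3] u) x * w x ∂μ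
      ≤ (∫ x, u x * (K^[2 * m] u) x * w x ∂μ) + ∫ x, u x * (K^[2 * m + 1] u) x * w x ∂μ := by
  have hv := iterate_mem hAK m hu
  have hz : A (fun s => (K^[1] (K^[m] u)) s + 1 * (K^[m] u) s) := hAc 1 (iterate_mem hAK 1 hv) hv
  -- `‖z‖² − ⟨z, Kz⟩ ≥ 0`
  have hq := quadForm_nonneg hw0 hAi hAK hcontr hz zero_le_one le_rfl
  have e0 : ∫ x, ((K^[1] (K^[m] u)) x + 1 * (K^[m] u) x) ^ 2 * w x ∂μ
      = ∫ x, ((K^[1] (K^[m] u)) x + 1 * (K^[m] u) x)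
        * (K^[0] (fun s => (K^[1] (K^[m] u)) s + 1 * (K^[m] u) s)) x * w x ∂μ := by
    simp only [Function.iterate_zero, id_eq, sq]
  have e1 : ∫ x, ((K^[1] (K^[m] u)) x + 1 * (K^[m] u) x)
      * K (fun s => (K^[1] (K^[m] u)) s + 1 * (K^[m] u) s) x * w x ∂μ
      = ∫ x, ((K^[1] (K^[m] u)) x + 1 * (K^[m] u) x)
        * (K^[1] (fun s => (K^[1] (K^[m] u)) s + 1 * (K^[m] u) s)) x * w x ∂μ := by
    simp only [Function.iterate_one]
  rw [e0, e1, one_mul, autocov_test_iterate hAi hAK hlin hsymm hv 1 1 0,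
    autocov_test_iterate hAi hAK hlin hsymm hv 1 1 1] at hq
  -- transport `C_v(j) = a(2m + j)`
  have e : ∀ j, ∫ x, (K^[m] u) x * (K^[j] (K^[m] u)) x * w x ∂μ
      = ∫ x, u x * (K^[2 * m + j] u) x * w x ∂μ := by
    intro j
    have h2 := two_time hAK hsymm hu m (j + m)
    simp only [← Function.iterate_add_apply] at h2 ⊢
    rw [h2, show m + (j + m) = 2 * m + j by ring]
  simp only [e] at hq
  norm_num at hq ⊢
  linarith

/-- **Geyer's convexity, every reversible exact sampler**: `Γ_{m+1} − Γ_{m+2} ≤ Γ_m − Γ_{m+1}` — the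
second difference `Γ_m − 2Γ_{m+1} + Γ_{m+2}` is the pair form `‖y‖² + ⟨y, Ky⟩ ≥ 0` of
`y = v − K² v`, `v = Kᵐ u`. -/
theorem pairSum_convex (hw0 : ∀ x, 0 ≤ w x)
    (hAi : ∀ ⦃f h : X → ℝ⦄, A f → A h → Integrable (fun x => f x * h x * w x) μ)
    (hAc : ∀ ⦃f h : X → ℝ⦄ (c : ℝ), A f → A h → A (fun x => f x + c * h x))
    (hAK : ∀ ⦃f : X → ℝ⦄, A f → A (K f))
    (hlin : ∀ ⦃f h : X → ℝ⦄ (c : ℝ), A f → A h →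
      ∀ x, K (fun s => f s + c * h s) x = K f x + c * K h x)
    (hsymm : ∀ ⦃f h : X → ℝ⦄, A f → A h →
      ∫ x, K f x * h x * w x ∂μ = ∫ x, f x * K h x * w x ∂μ)
    (hcontr : ∀ ⦃f : X → ℝ⦄, A f → ∫ x, K f x ^ 2 * w x ∂μ ≤ ∫ x, f x ^ 2 * w x ∂μ)
    {u : X → ℝ} (hu : A u) (m : ℕ) :
    ((∫ x, u x * (K^[2 * m + 2] u) x * w x ∂μ) + ∫ x, u x * (K^[2 * m + 3] u) x * w x ∂μ)
        - ((∫ x, u x * (K^[2 * m + 4] u) x * w x ∂μ) + ∫ x, u x * (K^[2 * m + 5] u) x * w x ∂μ)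
      ≤ ((∫ x, u x * (K^[2 * m] u) x * w x ∂μ) + ∫ x, u x * (K^[2 * m + 1] u) x * w x ∂μ)
        - ((∫ x, u x * (K^[2 * m + 2] u) x * w x ∂μ) + ∫ x, u x * (K^[2 * m + 3] u) x * w x ∂μ) := by
  have hv := iterate_mem hAK m hu
  have hy : A (fun s => (K^[2] (K^[m] u)) s + (-1) * (K^[m] u) s) :=
    hAc (-1) (iterate_mem hAK 2 hv) hv
  -- pair positivity at `m = 0` for `y`: `0 ≤ ‖y‖² + ⟨y, Ky⟩`
  have hp := pair_nonneg hw0 hAi hAK hsymm hcontr hy 0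
  simp only [Nat.mul_zero, Nat.zero_add] at hp
  rw [autocov_test_iterate hAi hAK hlin hsymm hv (-1) 2 0,
    autocov_test_iterate hAi hAK hlin hsymm hv (-1) 2 1] at hp
  have e : ∀ j, ∫ x, (K^[m] u) x * (K^[j] (K^[m] u)) x * w x ∂μ
      = ∫ x, u x * (K^[2 * m + j] u) x * w x ∂μ := by
    intro j
    have h2 := two_time hAK hsymm hu m (j + m)
    simp only [← Function.iterate_add_apply] at h2 ⊢
    rw [h2, show m + (j + m) = 2 * m + j by ring]
  simp only [e] at hp
  norm_num at hp ⊢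
  linarith

/-- `Γ_m ≤ Γ_0 = a(0) + a(1)` for every `m`. -/
theorem pairSum_le_first (hw0 : ∀ x, 0 ≤ w x)
    (hAi : ∀ ⦃f h : X → ℝ⦄, A f → A h → Integrable (fun x => f x * h x * w x) μ)
    (hAc : ∀ ⦃f h : X → ℝ⦄ (c : ℝ), A f → A h → A (fun x => f x + c * h x))
    (hAK : ∀ ⦃f : X → ℝ⦄, A f → A (K f))
    (hlin : ∀ ⦃f h : X → ℝ⦄ (c : ℝ), A f → A h →
      ∀ x, K (fun s => f s + c * h s) x = K f x + c * K h x)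
    (hsymm : ∀ ⦃f h : X → ℝ⦄, A f → A h →
      ∫ x, K f x * h x * w x ∂μ = ∫ x, f x * K h x * w x ∂μ)
    (hcontr : ∀ ⦃f : X → ℝ⦄, A f → ∫ x, K f x ^ 2 * w x ∂μ ≤ ∫ x, f x ^ 2 * w x ∂μ)
    {u : X → ℝ} (hu : A u) :
    ∀ m : ℕ, (∫ x, u x * (K^[2 * m] u) x * w x ∂μ) + ∫ x, u x * (K^[2 * m + 1] u) x * w x ∂μ
      ≤ (∫ x, u x ^ 2 * w x ∂μ) + ∫ x, u x * K u x * w x ∂μ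
  | 0 => by simp [sq]
  | m + 1 => by
    have h1 := pairSum_succ_le hw0 hAi hAc hAK hlin hsymm hcontr hu m
    have h2 := pairSum_le_first hw0 hAi hAc hAK hlin hsymm hcontr hu m
    rw [show 2 * (m + 1) = 2 * m + 2 by ring, show 2 * m + 2 + 1 = 2 * m + 3 by ring]
    linarith

/-! ## §3 Tails starting at an even lag are nonnegative; odd windows are floors -/

/-- Finite sums of whole pairs starting at an even lag are nonnegative:
`0 ≤ Σ_{n < 2M} a(2N + n)`. -/
theorem sum_tail_pairs_nonneg (hw0 : ∀ x, 0 ≤ w x)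
    (hAi : ∀ ⦃f h : X → ℝ⦄, A f → A h → Integrable (fun x => f x * h x * w x) μ)
    (hAK : ∀ ⦃f : X → ℝ⦄, A f → A (K f))
    (hsymm : ∀ ⦃f h : X → ℝ⦄, A f → A h →
      ∫ x, K f x * h x * w x ∂μ = ∫ x, f x * K h x * w x ∂μ)
    (hcontr : ∀ ⦃f : X → ℝ⦄, A f → ∫ x, K f x ^ 2 * w x ∂μ ≤ ∫ x, f x ^ 2 * w x ∂μ)
    {u : X → ℝ} (hu : A u) (N : ℕ) :
    ∀ M : ℕ, 0 ≤ ∑ n ∈ Finset.range (2 * M), ∫ x, u x * (K^[2 * N + n] u) x * w x ∂μ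
  | 0 => by simp
  | M + 1 => by
    rw [show 2 * (M + 1) = 2 * M + 1 + 1 by ring, Finset.sum_range_succ, Finset.sum_range_succ]
    have h1 := sum_tail_pairs_nonneg hw0 hAi hAK hsymm hcontr hu N M
    have h2 := pair_nonneg hw0 hAi hAK hsymm hcontr hu (N + M)
    rw [show 2 * (N + M) = 2 * N + 2 * M by ring, show 2 * N + 2 * M + 1 = 2 * N + (2 * M + 1) by ring]
      at h2
    linarith

/-- **Every tail that starts at an even lag has a nonnegative sum** (summable case):
`0 ≤ Σ_{n ≥ 0} a(2N + n)`. -/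
theorem tsum_even_tail_nonneg (hw0 : ∀ x, 0 ≤ w x)
    (hAi : ∀ ⦃f h : X → ℝ⦄, A f → A h → Integrable (fun x => f x * h x * w x) μ)
    (hAK : ∀ ⦃f : X → ℝ⦄, A f → A (K f))
    (hsymm : ∀ ⦃f h : X → ℝ⦄, A f → A h →
      ∫ x, K f x * h x * w x ∂μ = ∫ x, f x * K h x * w x ∂μ)
    (hcontr : ∀ ⦃f : X → ℝ⦄, A f → ∫ x, K f x ^ 2 * w x ∂μ ≤ ∫ x, f x ^ 2 * w x ∂μ)
    {u : X → ℝ} (hu : A u) (N : ℕ)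
    (hs : Summable fun n => ∫ x, u x * (K^[2 * N + n] u) x * w x ∂μ) :
    0 ≤ ∑' n, ∫ x, u x * (K^[2 * N + n] u) x * w x ∂μ := by
  have ht := hs.hasSum.tendsto_sum_nat
  have h2 : Tendsto (fun M : ℕ => 2 * M) atTop atTop :=
    tendsto_atTop_mono (fun M => Nat.le_mul_of_pos_left M two_pos) tendsto_id
  exact ge_of_tendsto' (ht.comp h2) fun M => sum_tail_pairs_nonneg hw0 hAi hAK hsymm hcontr hu N M

/-- **ODD WINDOWS NEVER OVERSHOOT, for every reversible exact sampler.**  With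
`ρ(k) = a(k)/a(0)` and a summable series: `τ_{2N+1} = ½ + Σ_{1 ≤ k ≤ 2N+1} ρ(k) ≤ τ_int` for every
`N` (the remainder `Σ_{k ≥ 2N+2} ρ(k)` is a sum of whole pairs). -/
theorem tauIntWindow_odd_le_tauInt (hw0 : ∀ x, 0 ≤ w x)
    (hAi : ∀ ⦃f h : X → ℝ⦄, A f → A h → Integrable (fun x => f x * h x * w x) μ)
    (hAK : ∀ ⦃f : X → ℝ⦄, A f → A (K f))
    (hsymm : ∀ ⦃f h : X → ℝ⦄, A f → A h →
      ∫ x, K f x * h x * w x ∂μ = ∫ x, f x * K h x * w x ∂μ)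
    (hcontr : ∀ ⦃f : X → ℝ⦄, A f → ∫ x, K f x ^ 2 * w x ∂μ ≤ ∫ x, f x ^ 2 * w x ∂μ)
    {u : X → ℝ} (hu : A u)
    (hs : Summable fun k => (∫ x, u x * (K^[k + 1] u) x * w x ∂μ) / ∫ x, u x ^ 2 * w x ∂μ)
    (N : ℕ) :
    tauIntWindow (fun k => (∫ x, u x * (K^[k] u) x * w x ∂μ) / ∫ x, u x ^ 2 * w x ∂μ) (2 * N + 1)
      ≤ tauInt (fun k => (∫ x, u x * (K^[k] u) x * w x ∂μ) / ∫ x, u x ^ 2 * w x ∂μ) := by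
  have hP0 : 0 ≤ ∫ x, u x ^ 2 * w x ∂μ := integral_nonneg fun x => mul_nonneg (sq_nonneg _) (hw0 x)
  unfold tauIntWindow tauInt
  -- split the series after `2N + 1` terms
  have hsplit := hs.sum_add_tsum_nat_add (2 * N + 1)
  have htail : 0 ≤ ∑' k, (∫ x, u x * (K^[k + (2 * N + 1) + 1] u) x * w x ∂μ)
      / ∫ x, u x ^ 2 * w x ∂μ := by
    rcases eq_or_lt_of_le hP0 with hz | hPpos
    · refine _root_.tsum_nonneg fun k => ?_
      rw [← hz, div_zero]
    · have hs' : Summable fun n => ∫ x, u x * (K^[2 * (N + 1) + n] u) x * w x ∂μ := by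
        have h := ((summable_nat_add_iff (2 * N + 1)).2 hs).mul_left (∫ x, u x ^ 2 * w x ∂μ)
        refine h.congr fun n => ?_
        rw [show 2 * (N + 1) + n = n + (2 * N + 1) + 1 by ring]
        field_simp
      have ht := tsum_even_tail_nonneg hw0 hAi hAK hsymm hcontr hu (N + 1) hs'
      have e : (fun k => ∫ x, u x * (K^[k + (2 * N + 1) + 1] u) x * w x ∂μ)
          = fun n => ∫ x, u x * (K^[2 * (N + 1) + n] u) x * w x ∂μ :=
        funext fun n => by rw [show n + (2 * N + 1) + 1 = 2 * (N + 1) + n by ring]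
      rw [tsum_div_const, e]
      exact div_nonneg ht hPpos.le
  linarith

/-- Real-sequence step: nonincreasing pair sums give `(M + 1)·(a(2M) + a(2M+1)) ≤ Σ_{k < 2M+2} a(k)`. -/
theorem succ_mul_pairSum_le_sum {a : ℕ → ℝ}
    (hstep : ∀ m : ℕ, a (2 * m + 2) + a (2 * m + 3) ≤ a (2 * m) + a (2 * m + 1)) :
    ∀ M : ℕ, ((M : ℝ) + 1) * (a (2 * M) + a (2 * M + 1)) ≤ ∑ k ∈ Finset.range (2 * M + 2), a k
  | 0 => by simp [Finset.sum_range_succ]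
  | M + 1 => by
    have ih := succ_mul_pairSum_le_sum hstep M
    have h := hstep M
    have e : ∑ k ∈ Finset.range (2 * (M + 1) + 2), a k
        = ∑ k ∈ Finset.range (2 * M + 2), a k + a (2 * M + 2) + a (2 * M + 3) := by
      rw [show 2 * (M + 1) + 2 = 2 * M + 2 + 1 + 1 by ring, Finset.sum_range_succ,
        Finset.sum_range_succ]
    rw [e, show 2 * (M + 1) + 1 = 2 * M + 3 by ring, show 2 * (M + 1) = 2 * M + 2 by ring]
    push_cast
    nlinarith [h, ih]

/-- **PAIR DECAY, every reversible exact sampler**: the pair sums are nonnegative, nonincreasing and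
add up to `τ_int + ½` (in units of `a(0)`), hence `(N + 1)·(ρ(2N) + ρ(2N+1)) ≤ τ_int + ½` — the
autocorrelations of any observable decay, in pairs, at least like `(τ_int + ½)/(N + 1)`. -/
theorem succ_mul_pairSum_le_tauInt (hw0 : ∀ x, 0 ≤ w x)
    (hAi : ∀ ⦃f h : X → ℝ⦄, A f → A h → Integrable (fun x => f x * h x * w x) μ)
    (hAc : ∀ ⦃f h : X → ℝ⦄ (c : ℝ), A f → A h → A (fun x => f x + c * h x))
    (hAK : ∀ ⦃f : X → ℝ⦄, A f → A (K f))
    (hlin : ∀ ⦃f h : X → ℝ⦄ (c : ℝ), A f → A h →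
      ∀ x, K (fun s => f s + c * h s) x = K f x + c * K h x)
    (hsymm : ∀ ⦃f h : X → ℝ⦄, A f → A h →
      ∫ x, K f x * h x * w x ∂μ = ∫ x, f x * K h x * w x ∂μ)
    (hcontr : ∀ ⦃f : X → ℝ⦄, A f → ∫ x, K f x ^ 2 * w x ∂μ ≤ ∫ x, f x ^ 2 * w x ∂μ)
    {u : X → ℝ} (hu : A u)
    (hs : Summable fun k => (∫ x, u x * (K^[k + 1] u) x * w x ∂μ) / ∫ x, u x ^ 2 * w x ∂μ)
    (N : ℕ) :
    ((N : ℝ) + 1) * ((∫ x, u x * (K^[2 * N] u) x * w x ∂μ) / (∫ x, u x ^ 2 * w x ∂μ)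
        + (∫ x, u x * (K^[2 * N + 1] u) x * w x ∂μ) / (∫ x, u x ^ 2 * w x ∂μ))
      ≤ tauInt (fun k => (∫ x, u x * (K^[k] u) x * w x ∂μ) / ∫ x, u x ^ 2 * w x ∂μ) + 1 / 2 := by
  set P := ∫ x, u x ^ 2 * w x ∂μ with hP
  set a : ℕ → ℝ := fun k => ∫ x, u x * (K^[k] u) x * w x ∂μ with ha
  have hP0 : 0 ≤ P := integral_nonneg fun x => mul_nonneg (sq_nonneg _) (hw0 x)
  have hstep : ∀ m : ℕ, a (2 * m + 2) + a (2 * m + 3) ≤ a (2 * m) + a (2 * m + 1) :=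
    fun m => pairSum_succ_le hw0 hAi hAc hAK hlin hsymm hcontr hu m
  have hsum := succ_mul_pairSum_le_sum hstep N
  have hwin := tauIntWindow_odd_le_tauInt hw0 hAi hAK hsymm hcontr hu hs N
  rcases eq_or_lt_of_le hP0 with hz | hPpos
  · -- degenerate observable: every autocovariance vanishes
    have hzero : ∀ k, a k = 0 := by
      intro k
      have h := abs_autocov_le hw0 hAi hAK hcontr hu k
      rw [← hP, ← hz] at h
      exact abs_nonpos_iff.1 h
    have hρ0 : ∀ k, a k / P = 0 := fun k => by rw [hzero k, zero_div]
    have ht : tauInt (fun k => a k / P) = 1 / 2 := by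
      unfold tauInt
      simp only [hρ0, tsum_zero, add_zero]
    simp only [ha] at hρ0 ht
    rw [hρ0, hρ0, ht]
    norm_num
  · -- `Σ_{k < 2N+2} a(k) = P (τ_{2N+1} + ½) ≤ P (τ_int + ½)`
    have hw : ∑ k ∈ Finset.range (2 * N + 2), a k
        = P * (tauIntWindow (fun k => a k / P) (2 * N + 1) + 1 / 2) := by
      unfold tauIntWindow
      rw [show 2 * N + 2 = 2 * N + 1 + 1 by ring, Finset.sum_range_succ', mul_add, mul_add,
        Finset.mul_sum]
      have e0 : a 0 = P := by simp [ha, hP, sq]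
      have e1 : ∀ k, P * (a (k + 1) / P) = a (k + 1) := fun k => by field_simp
      simp only [e1, e0]
      ring
    rw [hw] at hsum
    have key : ((N : ℝ) + 1) * (a (2 * N) + a (2 * N + 1))
        ≤ P * (tauInt (fun k => a k / P) + 1 / 2) := by
      simp only [ha] at hsum hwin ⊢
      nlinarith [hsum, hwin, hPpos]
    have e : ((N : ℝ) + 1) * (a (2 * N) / P + a (2 * N + 1) / P)
        = ((N : ℝ) + 1) * (a (2 * N) + a (2 * N + 1)) / P := by
      field_simp
    simp only [ha] at e key ⊢
    rw [e, div_le_iff₀ hPpos]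
    linarith

end RevOp

end Summit.Ventures.LatticeQCDFlow.Exactness
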